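import Mathlib.LinearAlgebra.Matrix.SchurComplement
import Mathlib.LinearAlgebra.Matrix.NonsingularInverse
import Mathlib.LinearAlgebra.Matrix.Hermitian
import Mathlib.Analysis.Calculus.Deriv.Slope
import Mathlib.Analysis.Calculus.Deriv.Mul
import Mathlib.Analysis.Calculus.Deriv.Add
import Mathlib.Topology.Instances.Matrix
import Mathlib.Tactic
import HarnessLib
import Literature.MathematicalPhysics.QuantumLattice.DownfoldingIdentities

/-!
# Löwdin partitioning («downfolding») of a one-body Hamiltonian: exact at the eigenvalue,
# and the exact size of the energy-independent (linearised) approximation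

Every one-band or few-band TIGHT-BINDING object of record in the cell `pub/hubbard-downfold` that is
not a Wannier projection is a LÖWDIN FOLD: the one-body Hamiltonian is written in a block basis
`H = [[H₀₀, V₀₁], [V₁₀, H₁₁]]` (active block `m` = the `x²−y²`-like channel(s) kept, passive block
`n` = the `3z²−r²`, Cu-4s, apical, O-2p… channels removed) and the passive block is eliminated
[MarzariEtAl2012, §III.B.2 «NMTO and Downfolding», the three displayed equations after «Let us
write the Hamiltonian for the system in a block representation» (arXiv:1112.5411 p. 19 L132 –
p. 20 L21), attributing the construction to Löwdin, J. Chem. Phys. 19, 1396 (1951) = `Lowdin1951`]: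
from `(H₀₀ − ε)ψ₀ + V₀₁ψ₁ = 0`, `V₁₀ψ₀ + (H₁₁ − ε)ψ₁ = 0` one gets
`H^eff₀₀(ε) = H₀₀ − V₀₁ (H₁₁ − ε)⁻¹ V₁₀`, and «This apparent simplification has introduced an
energy dependence into the Hamiltonian. One practical way forward is to approximate this as an
energy-independent Hamiltonian `H^eff₀₀(ε₀)`, choosing the reference energy `ε₀` to be the average
energy of the states of interest» (loc. cit.).

What is EXACT here (pure matrix algebra over a field; `0` facts):

* §1 `effHam A B C D ε = A − B (D − ε·1)⁻¹ C` (the printed `H^eff₀₀(ε)` with `A = H₀₀`, `B = V₀₁`,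
  `C = V₁₀`, `D = H₁₁`), and the block shift `H − ε·1 = [[A − ε·1, B], [C, D − ε·1]]`.
* §2 SPECTRAL EXACTNESS: whenever `ε` is not an eigenvalue of the passive block
  (`det (D − ε·1)` a unit), `det (H − ε·1) = det (D − ε·1) · det (effHam ε − ε·1)`
  (`det_sub_smul_one_eq`, from Mathlib's Schur-complement determinant `Matrix.det_fromBlocks₂₂`);
  hence `ε` is an eigenvalue of `H` iff it is an eigenvalue of the ENERGY-DEPENDENT downfolded
  Hamiltonian evaluated AT `ε` (`det_sub_eq_zero_iff`) — downfolding loses no eigenvalue outside the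
  passive spectrum and creates none.
* §3 EIGENVECTOR EXACTNESS: if `(x, y)` solves the block eigen-equations at `ε` then
  `y = −(D − ε·1)⁻¹ C x` (`passive_eq`) and `effHam ε · x = ε x` (`effHam_mulVec_eq`); conversely every
  solution `x` of the downfolded problem at `ε` lifts, with that `y`, to an eigenvector of `H`
  (`lift_active_eq`, `lift_passive_eq`; packaged with `Matrix.fromBlocks` in `fromBlocks_mulVec_lift`).
  The active component of the TRUE eigenvector is the downfolded eigenvector itself — not a
  renormalised copy; the normalisation `1 + ‖y‖²` lives entirely in the passive tail.
* §4 THE PRICE OF ENERGY-INDEPENDENCE, EXACTLY: for two admissible energies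
  `effHam ε − effHam ε₀ = (ε₀ − ε) · B (D − ε·1)⁻¹ (D − ε₀·1)⁻¹ C` (`effHam_sub_effHam`, via the first
  resolvent identity `resolvent_sub_resolvent`, proved here). So the linearised one-band Hamiltonian
  `effHam ε₀` used AS IF energy-independent misjudges the exact operator at a band energy `ε` by a term
  LINEAR in `ε − ε₀` whose coefficient is the two-resolvent sandwich — small iff the passive levels are
  far from BOTH `ε` and `ε₀` on the scale of the hybridisation `B`; this is the quantity an `N`-th order
  (NMTO-type) polynomial fit in `ε` removes order by order [MarzariEtAl2012, §III.B.2, last paragraph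
  before the tetrahedral-semiconductor example].
* §5 ONE PASSIVE LEVEL: if the passive block is a single level (or a degenerate shell) `D = d·1`,
  `effHam ε = A − (d − ε)⁻¹ · (B C)` (`effHam_scalar_passive`): the fold of a level at `d` adds to the
  active block the rank-`≤ |n|` matrix `B C` with weight `1/(ε − d)` — positive (levels pushed UP, and for
  `C = Bᴴ` a positive-semidefinite correction) when the removed level lies BELOW the band energy,
  negative when it lies ABOVE. This is the exact statement behind the cell's located readings «a
  virtual `3z²−r²`/apical level below the `x²−y²` band folds in with one sign, the Cu-4s level above with
  the other» (lit/REFVALS-1.md §D7, §11; router/BOXES/La2CuO4-family.md l.82): which hoppings (`t′`,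
  `t″`) the correction feeds is decided by the pattern of `B C`, its SIGN by `ε − d` alone.
* §6 HERMITICITY: for Hermitian blocks (`C = Bᴴ`, `A`, `D` Hermitian) and a self-adjoint energy,
  `effHam ε` is Hermitian (`effHam_isHermitian`) — the downfolded object is a bona fide Hamiltonian at
  every real energy, energy-dependent or linearised.
* §7 BRIDGE to `DownfoldingIdentities.loewdinHam` (`effHam_eq_loewdinHam`, unconditional; the
  determinant factorisation re-expressed there: `det_sub_smul_one_eq_loewdinHam`).
* §8 THE NORMALISATION («MODEL-SPACE WEIGHT») IDENTITY AND THE ENERGY DERIVATIVE OF THE FOLD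
  [LiWu2022, App. «Bloch-Horowitz theory», the displayed normalisation equation
  `1 = ⟨ψ_P|(1 + H_PQ (E − H_QQ)⁻² H_QP)|ψ_P⟩ = ⟨ψ_P|(1 − ∂H_eff(E)/∂E)|ψ_P⟩` (arXiv:2204.05510, tex
  chunk p0015 L32–37), citing Lepage1997 §3 «the standard normalization condition for the wavefunction
  when the potential is energy dependent: 1 = ∫ψ†(1 − ∂V/∂E)ψ. The second term … gives the probability
  carried by all Fock states other than …» (arXiv:nucl-th/9706029, chunk p0012 L94–100)]. For Hermitian
  blocks (`C = Bᴴ`, `D` Hermitian, self-adjoint `ε`): the passive tail of the exact eigenvector has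
  `⟨y, y⟩ = ⟨x, B (D − ε)⁻² Bᴴ x⟩` (`passive_normSq_eq`), hence `⟨x,x⟩ + ⟨y,y⟩ = ⟨x, (1 + B (D − ε)⁻² Bᴴ) x⟩`
  (`normSq_active_add_passive`) and the ACTIVE-SUBSPACE WEIGHT of the true eigenvector is
  `⟨x,x⟩ / ⟨x,(1 + S)x⟩` with `S = B (D − ε)⁻² Bᴴ` (`activeWeight_eq`; one active orbital:
  `(1 + S₀₀)⁻¹`, `activeWeight_eq_unique`). Over `ℝ`/`ℂ` (any nontrivially normed field) the fold is
  differentiable in the energy off the passive spectrum with `∂_ε (H^eff₀₀(ε))_{ij} = −(B (D − ε)⁻² C)_{ij}`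
  (`hasDerivAt_effHam_apply`, from §4's exact secant `effHam_sub_effHam` and continuity of the passive
  resolvent `continuousAt_passiveRes`), and `∂_ε ⟨x, H^eff₀₀(ε) x⟩ = −⟨x, B (D − ε)⁻² C x⟩`
  (`hasDerivAt_dotProduct_effHam_mulVec`) — so `S = −∂_ε H^eff₀₀` and the weight is the printed
  `⟨x,x⟩/⟨x,(1 − ∂_ε H^eff₀₀)x⟩`: the quasiparticle-weight form `Z = (1 − ∂_ω Σ)⁻¹` of the eliminated
  subspace, EXACT for a one-body fold (the `x²−y²`/Cu-`d` weight of a one-band target inside a `d–p`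
  basis is this number at the Fermi energy). One kept orbital against a degenerate passive shell at `d`:
  `w = (1 + Σ_j|V₀ⱼ|²/(ε − d)²)⁻¹ = Δ²/(Δ² + Σ_j|V₀ⱼ|²)`, `Δ = ε − d`
  (`activeWeight_eq_unique_scalar_passive`, `…'`) — the EXACT form of the «admixture ≈ |V|²/Δ²» estimate,
  with `Δ` measured from the BAND energy.

* §9 LEVEL-SHIFT LEVERS (Hellmann–Feynman in fold form; one kept orbital): a rigid shift of the
  passive block is an energy shift of the fold, `H^eff[D − s·1](ε) = H^eff[D](ε + s)`
  (`effHam_passive_shift`), a rigid shift of the active block passes through, `H^eff[A + s·1] =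
  H^eff[A] + s·1` (`effHam_active_shift`); hence for a differentiable branch of band energies of the
  one-orbital secular equation the ACTIVE-LEVEL LEVER is `dλ/ds = (1 + S)⁻¹` = the kept-orbital weight
  of §8 (`activeShift_eigenvalue_deriv_mul/_eq/_eq_activeWeight`) and the PASSIVE-LEVEL LEVER is
  `dμ/ds = 1 − (1 + S)⁻¹` = the removed-orbital weight (`passiveShift_eigenvalue_deriv_mul/_eq`), the two
  adding to one (`activeLever_add_passiveLever`), with EXACT SECANT forms needing no branch hypothesis
  (`activeShift_secant`: `(λ₁ − λ₂)(1 + S₁₂) = s₁ − s₂` with the two-energy sandwich of §4;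
  `passiveShift_secant`); two momenta separate at the rate of their weight contrast
  (`hasDerivAt_activeShift_gap`) — the exact content of the located statement that a Hartree
  double-counting shift of `ε_d` changes the one-band image of a `d–p` model «both in shape and the
  bandwidth» [VucicevicZitko2026, App. B]; for the cell: a three-band set's (reference-level) tag moves
  the one-band `t`, `t′/t` read off it by (level shift) × (d-weight contrast along the band).

RELATION TO `DownfoldingIdentities.lean` §2 (same topic directory; Bloch–Horowitz / Feshbach / Löwdin after
[BognerKuoSchwenk2003, §2.1 Eqs. (22)–(24)]): the operator `loewdinHam A B C D ω = A + B (ω·1 − D)⁻¹ C`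
there IS `effHam` here (opposite sign convention for the passive resolvent; §7 `effHam_eq_loewdinHam`,
unconditionally, via `passiveRes_eq_neg_inv`), and that file's `fromBlocks_mulVec_eq_smul_iff` /
`loewdinHam_mulVec_of_eigen` / `eigen_of_loewdinHam_mulVec` already carry the eigenvector package that
§3 restates in the `(D − ε)` convention (kept here as the working form for §4–§5; no new content is
claimed for §3). NEW relative to that file: the secular-determinant factorisation and spectrum iff (§2;
re-expressed for `loewdinHam` in `det_sub_smul_one_eq_loewdinHam`), the resolvent identity and the
exact linearisation error (§4), the one-passive-level sign rule (§5), Hermiticity (§6).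

WHAT THIS FILE IS NOT: not a statement about Wannier-projected objects (those are not Löwdin folds:
[MarzariEtAl2012, §III.B.2] «some authors use this term to refer to any scheme to produce a minimal
basis-set representation»); not an error BOUND for a linearised fold (§4 is an identity; turning it into
a number needs the passive spectrum and `B` of a given material, i.e. a box of record); nothing here is
specific to cuprates.
-/

namespace Literature.MathematicalPhysics.QuantumLattice.Loewdin

open Matrix

variable {m n K : Type*} [Fintype n] [DecidableEq n] [Field K]

/-! ### §1 The energy-dependent downfolded Hamiltonian -/

/-- The passive-block resolvent `(H₁₁ − ε·1)⁻¹` (Mathlib's nonsingular inverse; it is a genuine inverse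
exactly when `det (H₁₁ − ε·1)` is a unit, i.e. `ε` is not a passive eigenvalue)
[cite: MarzariEtAl2012, §III.B.2]. -/
noncomputable def passiveRes (D : Matrix n n K) (ε : K) : Matrix n n K :=
  (D - ε • (1 : Matrix n n K))⁻¹

/-- Löwdin's energy-dependent effective («downfolded») Hamiltonian on the active block,
`H^eff₀₀(ε) = H₀₀ − V₀₁ (H₁₁ − ε)⁻¹ V₁₀` with `A = H₀₀`, `B = V₀₁`, `C = V₁₀`, `D = H₁₁`
[cite: MarzariEtAl2012, §III.B.2, third displayed equation of the subsection (arXiv:1112.5411 p. 20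
L15); construction due to Lowdin1951]. -/
noncomputable def effHam (A : Matrix m m K) (B : Matrix m n K) (C : Matrix n m K) (D : Matrix n n K)
    (ε : K) : Matrix m m K :=
  A - B * passiveRes D ε * C

/-- Unfolding lemma for `passiveRes` [cite: MarzariEtAl2012, §III.B.2]. -/
theorem passiveRes_def (D : Matrix n n K) (ε : K) :
    passiveRes D ε = (D - ε • (1 : Matrix n n K))⁻¹ := rfl

/-- Unfolding lemma for `effHam`: `H^eff₀₀(ε) = H₀₀ − V₀₁ (H₁₁ − ε)⁻¹ V₁₀` as printed
[cite: MarzariEtAl2012, §III.B.2]. -/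
theorem effHam_def (A : Matrix m m K) (B : Matrix m n K) (C : Matrix n m K) (D : Matrix n n K)
    (ε : K) : effHam A B C D ε = A - B * (D - ε • (1 : Matrix n n K))⁻¹ * C := rfl

omit [Fintype n] in
/-- The block form of `H − ε·1`: the shift lands on the diagonal blocks only
[cite: MarzariEtAl2012, §III.B.2, the two block eigen-equations]. -/
theorem fromBlocks_sub_smul_one [DecidableEq m] (A : Matrix m m K) (B : Matrix m n K)
    (C : Matrix n m K) (D : Matrix n n K) (ε : K) :
    fromBlocks A B C D - ε • (1 : Matrix (m ⊕ n) (m ⊕ n) K)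
      = fromBlocks (A - ε • (1 : Matrix m m K)) B C (D - ε • (1 : Matrix n n K)) := by
  rw [← fromBlocks_one, fromBlocks_smul, sub_eq_add_neg, fromBlocks_neg, fromBlocks_add]
  simp [sub_eq_add_neg]

/-! ### §2 Spectral exactness -/

/-- SCHUR-COMPLEMENT FACTORISATION OF THE SECULAR DETERMINANT: if `ε` is not a passive eigenvalue,
`det (H − ε·1) = det (H₁₁ − ε·1) · det (H^eff₀₀(ε) − ε·1)`
[cite: MarzariEtAl2012, §III.B.2 («Elimination of |ψ₁⟩ gives an effective Hamiltonian … which acts only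
on the active subspace»); determinant form via Mathlib `Matrix.det_fromBlocks₂₂`]. -/
theorem det_sub_smul_one_eq [Fintype m] [DecidableEq m] (A : Matrix m m K) (B : Matrix m n K)
    (C : Matrix n m K) (D : Matrix n n K) (ε : K) (hD : IsUnit (D - ε • (1 : Matrix n n K)).det) :
    (fromBlocks A B C D - ε • (1 : Matrix (m ⊕ n) (m ⊕ n) K)).det
      = (D - ε • (1 : Matrix n n K)).det * (effHam A B C D ε - ε • (1 : Matrix m m K)).det := by
  rw [fromBlocks_sub_smul_one]
  letI : Invertible (D - ε • (1 : Matrix n n K)) := invertibleOfIsUnitDet _ hD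
  rw [det_fromBlocks₂₂, invOf_eq_nonsing_inv]
  congr 2
  rw [effHam_def]
  abel

/-- DOWNFOLDING IS EXACT ON THE SPECTRUM: away from the passive eigenvalues, `ε` is an eigenvalue of
the full block Hamiltonian iff it is an eigenvalue of the energy-dependent downfolded Hamiltonian
EVALUATED AT `ε` [cite: MarzariEtAl2012, §III.B.2]. -/
theorem det_sub_eq_zero_iff [Fintype m] [DecidableEq m] (A : Matrix m m K) (B : Matrix m n K)
    (C : Matrix n m K) (D : Matrix n n K) (ε : K) (hD : IsUnit (D - ε • (1 : Matrix n n K)).det) :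
    (fromBlocks A B C D - ε • (1 : Matrix (m ⊕ n) (m ⊕ n) K)).det = 0
      ↔ (effHam A B C D ε - ε • (1 : Matrix m m K)).det = 0 := by
  rw [det_sub_smul_one_eq A B C D ε hD]
  constructor
  · intro h
    rcases mul_eq_zero.mp h with h | h
    · exact absurd h hD.ne_zero
    · exact h
  · intro h
    rw [h, mul_zero]

/-! ### §3 Eigenvector exactness -/

section eigenvectors

variable [Fintype m] {A : Matrix m m K} {B : Matrix m n K} {C : Matrix n m K} {D : Matrix n n K} {ε : K}

/-- ELIMINATION OF THE PASSIVE COMPONENT: from `V₁₀ x + H₁₁ y = ε y` and `ε ∉ spec H₁₁`,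
`y = −(H₁₁ − ε)⁻¹ V₁₀ x` [cite: MarzariEtAl2012, §III.B.2 («Elimination of |ψ₁⟩»); the printed
energy-dependent passive admixture `φ₀(ε) = φ₀ − φ₁ (H₁₁ − ε)⁻¹ V₁₀` of the same subsection]. -/
theorem passive_eq (hD : IsUnit (D - ε • (1 : Matrix n n K)).det) {x : m → K} {y : n → K}
    (h₁ : C *ᵥ x + D *ᵥ y = ε • y) :
    y = -(((D - ε • (1 : Matrix n n K))⁻¹ * C) *ᵥ x) := by
  have hDy : D *ᵥ y = ε • y - C *ᵥ x := by rw [← h₁]; abel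
  have hy : (D - ε • (1 : Matrix n n K)) *ᵥ y = -(C *ᵥ x) := by
    rw [sub_mulVec, smul_mulVec, one_mulVec, hDy]; abel
  calc y = ((D - ε • (1 : Matrix n n K))⁻¹ * (D - ε • (1 : Matrix n n K))) *ᵥ y := by
          rw [nonsing_inv_mul _ hD, one_mulVec]
    _ = (D - ε • (1 : Matrix n n K))⁻¹ *ᵥ ((D - ε • (1 : Matrix n n K)) *ᵥ y) := by
          rw [mulVec_mulVec]
    _ = -(((D - ε • (1 : Matrix n n K))⁻¹ * C) *ᵥ x) := by
          rw [hy, mulVec_neg, mulVec_mulVec]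

/-- THE ACTIVE COMPONENT OF A TRUE EIGENVECTOR SOLVES THE DOWNFOLDED PROBLEM AT THE TRUE ENERGY:
`H^eff₀₀(ε) x = ε x` [cite: MarzariEtAl2012, §III.B.2]. -/
theorem effHam_mulVec_eq (hD : IsUnit (D - ε • (1 : Matrix n n K)).det) {x : m → K} {y : n → K}
    (h₀ : A *ᵥ x + B *ᵥ y = ε • x) (h₁ : C *ᵥ x + D *ᵥ y = ε • y) :
    effHam A B C D ε *ᵥ x = ε • x := by
  have hy : ((D - ε • (1 : Matrix n n K))⁻¹ * C) *ᵥ x = -y := by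
    rw [passive_eq hD h₁, neg_neg]
  rw [effHam_def, sub_mulVec, Matrix.mul_assoc, ← mulVec_mulVec, hy, mulVec_neg, sub_neg_eq_add, h₀]

/-- LIFT, ACTIVE EQUATION: a downfolded eigenvector `x` at `ε`, completed by the passive tail
`y = −(H₁₁ − ε)⁻¹ V₁₀ x`, satisfies the active block equation `H₀₀ x + V₀₁ y = ε x`
[cite: MarzariEtAl2012, §III.B.2]. -/
theorem lift_active_eq {x : m → K} (hx : effHam A B C D ε *ᵥ x = ε • x) :
    A *ᵥ x + B *ᵥ (-(((D - ε • (1 : Matrix n n K))⁻¹ * C) *ᵥ x)) = ε • x := by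
  rw [← hx, effHam_def, sub_mulVec, Matrix.mul_assoc,
    ← mulVec_mulVec x B ((D - ε • (1 : Matrix n n K))⁻¹ * C), mulVec_neg]
  abel

/-- LIFT, PASSIVE EQUATION: with the same tail, `V₁₀ x + H₁₁ y = ε y` holds identically (no condition
on `x` beyond `ε ∉ spec H₁₁`) [cite: MarzariEtAl2012, §III.B.2]. -/
theorem lift_passive_eq (hD : IsUnit (D - ε • (1 : Matrix n n K)).det) (x : m → K) :
    C *ᵥ x + D *ᵥ (-(((D - ε • (1 : Matrix n n K))⁻¹ * C) *ᵥ x))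
      = ε • (-(((D - ε • (1 : Matrix n n K))⁻¹ * C) *ᵥ x)) := by
  set R : Matrix n n K := (D - ε • (1 : Matrix n n K))⁻¹ with hR
  set w : n → K := C *ᵥ x with hw
  have hDR : D * R = 1 + ε • R := by
    have : D = (D - ε • (1 : Matrix n n K)) + ε • (1 : Matrix n n K) := by abel
    rw [this, Matrix.add_mul, mul_nonsing_inv _ hD, smul_mul, Matrix.one_mul]
  have hDRw : D *ᵥ (R *ᵥ w) = w + ε • (R *ᵥ w) := by
    rw [mulVec_mulVec, hDR, add_mulVec, one_mulVec, smul_mulVec]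
  rw [← mulVec_mulVec, mulVec_neg, hDRw, smul_neg]
  abel

/-- THE TWO-WAY PACKAGE in Mathlib's block language: for `ε ∉ spec H₁₁`, the block vector
`(x, −(H₁₁ − ε)⁻¹ V₁₀ x)` is an eigenvector of `[[H₀₀, V₀₁], [V₁₀, H₁₁]]` with eigenvalue `ε` iff `x`
is an eigenvector of `H^eff₀₀(ε)` with eigenvalue `ε` [cite: MarzariEtAl2012, §III.B.2]. -/
theorem fromBlocks_mulVec_lift (hD : IsUnit (D - ε • (1 : Matrix n n K)).det) (x : m → K) :
    fromBlocks A B C D *ᵥ Sum.elim x (-(((D - ε • (1 : Matrix n n K))⁻¹ * C) *ᵥ x))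
        = ε • Sum.elim x (-(((D - ε • (1 : Matrix n n K))⁻¹ * C) *ᵥ x))
      ↔ effHam A B C D ε *ᵥ x = ε • x := by
  rw [fromBlocks_mulVec, Sum.elim_comp_inl, Sum.elim_comp_inr]
  have hsmul : ε • Sum.elim x (-(((D - ε • (1 : Matrix n n K))⁻¹ * C) *ᵥ x))
      = Sum.elim (ε • x) (ε • (-(((D - ε • (1 : Matrix n n K))⁻¹ * C) *ᵥ x))) := by
    funext i
    cases i <;> rfl
  rw [hsmul]
  constructor
  · intro h
    have h₀ := congrArg (fun f => f ∘ Sum.inl) h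
    have h₁ := congrArg (fun f => f ∘ Sum.inr) h
    simp only [Sum.elim_comp_inl, Sum.elim_comp_inr] at h₀ h₁
    exact effHam_mulVec_eq hD h₀ h₁
  · intro hx
    rw [lift_active_eq hx, lift_passive_eq hD x]

end eigenvectors

/-! ### §4 The exact size of the energy-independent approximation -/

/-- FIRST RESOLVENT IDENTITY for the passive block:
`(H₁₁ − ε)⁻¹ − (H₁₁ − ε₀)⁻¹ = (ε − ε₀) (H₁₁ − ε)⁻¹ (H₁₁ − ε₀)⁻¹`, both energies outside the passive
spectrum [cite: MarzariEtAl2012, §III.B.2 (the energy dependence of `H^eff₀₀`); algebraic identity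
proved here]. -/
theorem resolvent_sub_resolvent (D : Matrix n n K) {ε ε₀ : K}
    (hε : IsUnit (D - ε • (1 : Matrix n n K)).det) (hε₀ : IsUnit (D - ε₀ • (1 : Matrix n n K)).det) :
    (D - ε • (1 : Matrix n n K))⁻¹ - (D - ε₀ • (1 : Matrix n n K))⁻¹
      = (ε - ε₀) • ((D - ε • (1 : Matrix n n K))⁻¹ * (D - ε₀ • (1 : Matrix n n K))⁻¹) := by
  set R : Matrix n n K := (D - ε • (1 : Matrix n n K))⁻¹ with hR
  set R₀ : Matrix n n K := (D - ε₀ • (1 : Matrix n n K))⁻¹ with hR₀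
  have key : R * ((D - ε₀ • (1 : Matrix n n K)) - (D - ε • (1 : Matrix n n K))) * R₀ = R - R₀ := by
    rw [Matrix.mul_sub, Matrix.sub_mul, Matrix.mul_assoc R (D - ε₀ • (1 : Matrix n n K)) R₀, hR₀,
      mul_nonsing_inv _ hε₀, Matrix.mul_one, hR, nonsing_inv_mul _ hε, Matrix.one_mul]
  have key2 : (D - ε₀ • (1 : Matrix n n K)) - (D - ε • (1 : Matrix n n K))
      = (ε - ε₀) • (1 : Matrix n n K) := by
    rw [sub_smul]; abel
  rw [← key, key2, Matrix.mul_smul, Matrix.mul_one, smul_mul]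

/-- THE LINEARISATION ERROR, EXACTLY: `H^eff₀₀(ε) − H^eff₀₀(ε₀) = (ε₀ − ε) V₀₁ (H₁₁ − ε)⁻¹ (H₁₁ − ε₀)⁻¹ V₁₀`.
Using the energy-independent `H^eff₀₀(ε₀)` at a band energy `ε ≠ ε₀` therefore misses the exact
downfolded operator by a term linear in `ε − ε₀` with the two-resolvent sandwich as coefficient
[cite: MarzariEtAl2012, §III.B.2 («approximate this as an energy-independent Hamiltonian
`H^eff₀₀(ε₀)`»; «an `n`th-order polynomial fit to the energy dependence»)]. -/
theorem effHam_sub_effHam (A : Matrix m m K) (B : Matrix m n K) (C : Matrix n m K) (D : Matrix n n K)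
    {ε ε₀ : K} (hε : IsUnit (D - ε • (1 : Matrix n n K)).det)
    (hε₀ : IsUnit (D - ε₀ • (1 : Matrix n n K)).det) :
    effHam A B C D ε - effHam A B C D ε₀
      = (ε₀ - ε) • (B * (D - ε • (1 : Matrix n n K))⁻¹ * (D - ε₀ • (1 : Matrix n n K))⁻¹ * C) := by
  rw [effHam_def, effHam_def, sub_sub_sub_cancel_left, Matrix.mul_assoc B, Matrix.mul_assoc B,
    ← Matrix.mul_sub, ← Matrix.sub_mul]
  have hres := resolvent_sub_resolvent D hε hε₀
  have hres' : (D - ε₀ • (1 : Matrix n n K))⁻¹ - (D - ε • (1 : Matrix n n K))⁻¹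
      = (ε₀ - ε) • ((D - ε • (1 : Matrix n n K))⁻¹ * (D - ε₀ • (1 : Matrix n n K))⁻¹) := by
    rw [← neg_sub, hres, ← neg_smul, neg_sub]
  rw [hres', smul_mul, Matrix.mul_smul, Matrix.mul_assoc, Matrix.mul_assoc, Matrix.mul_assoc]

/-! ### §5 One passive level (or a degenerate passive shell) -/

/-- The resolvent of a scalar passive block: `(d·1 − ε·1)⁻¹ = (d − ε)⁻¹·1` for `d ≠ ε` (the passive
resolvent of [cite: MarzariEtAl2012, §III.B.2] specialised to `H₁₁ = d·1`). -/
theorem passiveRes_scalar (d ε : K) (h : d ≠ ε) :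
    (d • (1 : Matrix n n K) - ε • (1 : Matrix n n K))⁻¹ = (d - ε)⁻¹ • (1 : Matrix n n K) := by
  have hne : d - ε ≠ 0 := sub_ne_zero.mpr h
  rw [← sub_smul]
  apply inv_eq_right_inv
  rw [smul_mul, Matrix.one_mul, smul_smul, mul_inv_cancel₀ hne, one_smul]

/-- ONE PASSIVE LEVEL: if the eliminated block is a single level (or a degenerate shell) at energy `d`,
`H^eff₀₀(ε) = H₀₀ − (d − ε)⁻¹ V₀₁ V₁₀ = H₀₀ + V₀₁V₁₀/(ε − d)`: the fold adds `V₀₁V₁₀` with weight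
`1/(ε − d)` — positive when the removed level lies BELOW the band energy, negative when ABOVE; the
hopping PATTERN it generates is that of `V₀₁V₁₀`, its sign that of `ε − d`
[cite: MarzariEtAl2012, §III.B.2 (the formula specialised to `H₁₁ = d·1`)]. -/
theorem effHam_scalar_passive (A : Matrix m m K) (B : Matrix m n K) (C : Matrix n m K) (d ε : K)
    (h : d ≠ ε) :
    effHam A B C (d • (1 : Matrix n n K)) ε = A - (d - ε)⁻¹ • (B * C) := by
  rw [effHam_def, passiveRes_scalar d ε h, Matrix.mul_smul, Matrix.mul_one, smul_mul]

/-- Same statement with the weight written as `1/(ε − d)` on the other side: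
`H^eff₀₀(ε) = H₀₀ + (ε − d)⁻¹ V₀₁V₁₀` [cite: MarzariEtAl2012, §III.B.2 (specialised to `H₁₁ = d·1`)]. -/
theorem effHam_scalar_passive' (A : Matrix m m K) (B : Matrix m n K) (C : Matrix n m K) (d ε : K)
    (h : d ≠ ε) :
    effHam A B C (d • (1 : Matrix n n K)) ε = A + (ε - d)⁻¹ • (B * C) := by
  rw [effHam_scalar_passive A B C d ε h, sub_eq_add_neg, ← neg_smul, ← inv_neg, neg_sub]

/-! ### §6 Hermiticity of the downfolded Hamiltonian -/

/-- For Hermitian blocks (`V₁₀ = V₀₁ᴴ`, `H₀₀`, `H₁₁` Hermitian) and a self-adjoint energy, the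
downfolded Hamiltonian `H^eff₀₀(ε)` is Hermitian [cite: MarzariEtAl2012, §III.B.2]. -/
theorem effHam_isHermitian [StarRing K] {A : Matrix m m K} {B : Matrix m n K} {D : Matrix n n K}
    {ε : K} (hA : A.IsHermitian) (hD : D.IsHermitian) (hε : IsSelfAdjoint ε) :
    (effHam A B Bᴴ D ε).IsHermitian := by
  rw [effHam_def]
  have h1 : (D - ε • (1 : Matrix n n K)).IsHermitian := hD.sub (isHermitian_one.smul hε)
  exact hA.sub (isHermitian_mul_mul_conjTranspose B h1.inv)

/-! ### §7 Bridge to `DownfoldingIdentities.loewdinHam` (the `(ω·1 − D)` convention) -/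

omit [Fintype n] in
/-- `det (D − ε·1)` is a unit iff `det (ε·1 − D)` is (they differ by the unit `(−1)^|n|`)
[cite: MarzariEtAl2012, §III.B.2 (the passive block `H₁₁ − ε`)]. -/
theorem isUnit_det_sub_smul_one_comm [Fintype n] (D : Matrix n n K) (ε : K) :
    IsUnit (D - ε • (1 : Matrix n n K)).det ↔ IsUnit (ε • (1 : Matrix n n K) - D).det := by
  have key : ∀ M : Matrix n n K, IsUnit M.det → IsUnit (-M).det := by
    intro M hM
    rw [det_neg]
    exact ((isUnit_one.neg).pow _).mul hM
  constructor
  · intro h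
    have := key _ h
    rwa [neg_sub] at this
  · intro h
    have := key _ h
    rwa [neg_sub] at this

/-- The two sign conventions for the passive resolvent agree unconditionally:
`(D − ε·1)⁻¹ = −(ε·1 − D)⁻¹` (Mathlib's nonsingular inverse is `0` on both sides when `ε` IS a
passive eigenvalue) [cite: MarzariEtAl2012, §III.B.2]. -/
theorem passiveRes_eq_neg_inv (D : Matrix n n K) (ε : K) :
    (D - ε • (1 : Matrix n n K))⁻¹ = -((ε • (1 : Matrix n n K) - D)⁻¹) := by
  by_cases h : IsUnit (D - ε • (1 : Matrix n n K)).det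
  · have h' : IsUnit (ε • (1 : Matrix n n K) - D).det := (isUnit_det_sub_smul_one_comm D ε).mp h
    apply inv_eq_right_inv
    rw [Matrix.mul_neg, ← neg_sub, Matrix.neg_mul, neg_neg, mul_nonsing_inv _ h']
  · have h' : ¬IsUnit (ε • (1 : Matrix n n K) - D).det :=
      fun hh => h ((isUnit_det_sub_smul_one_comm D ε).mpr hh)
    rw [nonsing_inv_apply_not_isUnit _ h, nonsing_inv_apply_not_isUnit _ h', neg_zero]

/-- BRIDGE: `effHam A B C D ε = loewdinHam A B C D ε` — the operator of this file is the one of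
`DownfoldingIdentities.lean` §2 [cite: MarzariEtAl2012, §III.B.2; BognerKuoSchwenk2003, §2.1 Eq. (24)]. -/
theorem effHam_eq_loewdinHam (A : Matrix m m K) (B : Matrix m n K) (C : Matrix n m K)
    (D : Matrix n n K) (ε : K) :
    effHam A B C D ε = Literature.MathematicalPhysics.QuantumLattice.loewdinHam A B C D ε := by
  rw [effHam_def, Literature.MathematicalPhysics.QuantumLattice.loewdinHam_def, passiveRes_eq_neg_inv,
    Matrix.mul_neg, Matrix.neg_mul, sub_neg_eq_add]

/-- The secular-determinant factorisation of §2 in the `loewdinHam` convention: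
`det (H − ε·1) = det (D − ε·1) · det (loewdinHam ε − ε·1)` for `ε` off the passive spectrum
[cite: MarzariEtAl2012, §III.B.2; BognerKuoSchwenk2003, §2.1 (text after Eq. (28), «the determinant
… factorizes»)]. -/
theorem det_sub_smul_one_eq_loewdinHam [Fintype m] [DecidableEq m] (A : Matrix m m K)
    (B : Matrix m n K) (C : Matrix n m K) (D : Matrix n n K) (ε : K)
    (hD : IsUnit (D - ε • (1 : Matrix n n K)).det) :
    (fromBlocks A B C D - ε • (1 : Matrix (m ⊕ n) (m ⊕ n) K)).det
      = (D - ε • (1 : Matrix n n K)).det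
        * (Literature.MathematicalPhysics.QuantumLattice.loewdinHam A B C D ε
            - ε • (1 : Matrix m m K)).det := by
  rw [← effHam_eq_loewdinHam]
  exact det_sub_smul_one_eq A B C D ε hD

/-! ### §8 The normalisation («model-space weight») identity and the energy derivative of the fold -/

section weight

variable [Fintype m] [DecidableEq m] [StarRing K]

omit [Fintype m] [DecidableEq m] in
/-- For a Hermitian passive block and a self-adjoint energy the passive resolvent is Hermitian:
`((H₁₁ − ε)⁻¹)ᴴ = (H₁₁ − ε)⁻¹` [cite: LiWu2022, App. «Bloch-Horowitz theory» (the resolvent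
`(E − H_QQ)⁻¹` of a Hermitian `H`)]. -/
theorem conjTranspose_passiveRes {D : Matrix n n K} (hD : D.IsHermitian) {ε : K}
    (hε : IsSelfAdjoint ε) : (passiveRes D ε)ᴴ = passiveRes D ε := by
  rw [passiveRes_def, conjTranspose_nonsing_inv, conjTranspose_sub, conjTranspose_smul,
    conjTranspose_one, hD.eq, hε.star_eq]

omit [DecidableEq m] in
/-- THE PASSIVE TAIL'S NORM AS AN ACTIVE-SPACE EXPECTATION VALUE: for Hermitian blocks (`V₁₀ = V₀₁ᴴ`,
`H₁₁` Hermitian) and a self-adjoint energy, the passive component `y = −(H₁₁ − ε)⁻¹ V₁₀ x` of the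
exact eigenvector (§3) has `⟨y, y⟩ = ⟨x, V₀₁ (H₁₁ − ε)⁻¹ (H₁₁ − ε)⁻¹ V₁₀ x⟩`
[cite: LiWu2022, App. «Bloch-Horowitz theory», the term `⟨ψ_P| H_PQ (E − H_QQ)⁻² H_QP |ψ_P⟩` of the
displayed normalisation equation]. -/
theorem passive_normSq_eq {B : Matrix m n K} {D : Matrix n n K} (hD : D.IsHermitian) {ε : K}
    (hε : IsSelfAdjoint ε) (x : m → K) :
    star (-((passiveRes D ε * Bᴴ) *ᵥ x)) ⬝ᵥ (-((passiveRes D ε * Bᴴ) *ᵥ x))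
      = star x ⬝ᵥ ((B * passiveRes D ε * passiveRes D ε * Bᴴ) *ᵥ x) := by
  rw [star_neg, neg_dotProduct, dotProduct_neg, neg_neg, star_mulVec, dotProduct_mulVec,
    vecMul_vecMul, ← dotProduct_mulVec, conjTranspose_mul, conjTranspose_conjTranspose,
    conjTranspose_passiveRes hD hε]
  simp only [Matrix.mul_assoc]

/-- THE PRINTED NORMALISATION IDENTITY: with `S = V₀₁ (H₁₁ − ε)⁻² V₁₀` (which is `−∂_ε H^eff₀₀(ε)`, see
`hasDerivAt_effHam_apply`), the full norm of the exact eigenvector `(x, y)` is an ACTIVE-space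
expectation value, `⟨x, x⟩ + ⟨y, y⟩ = ⟨x, (1 + S) x⟩` — i.e. `1 = ⟨ψ_P|(1 − ∂_E H_eff(E))|ψ_P⟩` for a
normalised `ψ` [cite: LiWu2022, App. «Bloch-Horowitz theory», displayed normalisation equation;
Lepage1997, §3 («1 = ∫ψ†(1 − ∂V/∂E)ψ»)]. -/
theorem normSq_active_add_passive {B : Matrix m n K} {D : Matrix n n K} (hD : D.IsHermitian) {ε : K}
    (hε : IsSelfAdjoint ε) (x : m → K) :
    star x ⬝ᵥ x + star (-((passiveRes D ε * Bᴴ) *ᵥ x)) ⬝ᵥ (-((passiveRes D ε * Bᴴ) *ᵥ x))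
      = star x ⬝ᵥ ((1 + B * passiveRes D ε * passiveRes D ε * Bᴴ) *ᵥ x) := by
  rw [passive_normSq_eq hD hε x, add_mulVec, one_mulVec, dotProduct_add]

/-- THE ACTIVE-SUBSPACE WEIGHT OF THE EXACT EIGENVECTOR («the probability carried by the model space»):
`⟨x,x⟩ / (⟨x,x⟩ + ⟨y,y⟩) = ⟨x,x⟩ / ⟨x,(1 + S)x⟩`, `S = V₀₁ (H₁₁ − ε)⁻² V₁₀ = −∂_ε H^eff₀₀(ε)` — the
quasiparticle-weight form `Z = ⟨x,x⟩/⟨x,(1 − ∂_ε H^eff₀₀)x⟩` of the eliminated subspace, exact for a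
one-body fold [cite: LiWu2022, App. «Bloch-Horowitz theory»; Lepage1997, §3 («The second term …
gives the probability carried by all Fock states other than» the model-space one)]. -/
theorem activeWeight_eq {B : Matrix m n K} {D : Matrix n n K} (hD : D.IsHermitian) {ε : K}
    (hε : IsSelfAdjoint ε) (x : m → K) :
    star x ⬝ᵥ x / (star x ⬝ᵥ x
        + star (-((passiveRes D ε * Bᴴ) *ᵥ x)) ⬝ᵥ (-((passiveRes D ε * Bᴴ) *ᵥ x)))
      = star x ⬝ᵥ x / (star x ⬝ᵥ ((1 + B * passiveRes D ε * passiveRes D ε * Bᴴ) *ᵥ x)) := by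
  rw [normSq_active_add_passive hD hε x]

/-- ONE ACTIVE ORBITAL (the one-band fold of a `d–p` or `(x²−y², 3z²−r², 4s, …)` basis): the weight of
the kept orbital in the exact eigenvector is `(1 + S)⁻¹` with the SCALAR `S = V₀₁ (H₁₁ − ε)⁻² V₁₀ =
−dε_eff/dε`, i.e. `w = (1 − dε_eff/dε)⁻¹` [cite: LiWu2022, App. «Bloch-Horowitz theory» (one-dimensional
`P` space); Lepage1997, §3]. -/
theorem activeWeight_eq_unique [Unique m] {B : Matrix m n K} {D : Matrix n n K} (hD : D.IsHermitian)
    {ε : K} (hε : IsSelfAdjoint ε) (x : m → K) (hx : star (x default) * x default ≠ 0) :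
    star x ⬝ᵥ x / (star x ⬝ᵥ x
        + star (-((passiveRes D ε * Bᴴ) *ᵥ x)) ⬝ᵥ (-((passiveRes D ε * Bᴴ) *ᵥ x)))
      = (1 + (B * passiveRes D ε * passiveRes D ε * Bᴴ) default default)⁻¹ := by
  rw [activeWeight_eq hD hε x]
  have h1 : star x ⬝ᵥ x = star (x default) * x default := by
    simp [dotProduct]
  have h2 : star x ⬝ᵥ ((1 + B * passiveRes D ε * passiveRes D ε * Bᴴ) *ᵥ x)
      = star (x default) * x default
          * (1 + (B * passiveRes D ε * passiveRes D ε * Bᴴ) default default) := by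
    simp only [dotProduct, mulVec, Fintype.sum_unique, Matrix.add_apply, Matrix.one_apply_eq,
      Pi.star_apply]
    ring
  rw [h1, h2, div_mul_cancel_left₀ hx]

/-- ONE ACTIVE ORBITAL AGAINST A DEGENERATE PASSIVE SHELL AT LEVEL `d` (e.g. the `x²−y²` band against the
`3z²−r²`/apical states lumped at one energy): the sandwich is `S₀₀ = Σ_j |V₀ⱼ|² / (d − ε)²`, so the kept-orbital
weight of the exact eigenvector is `(1 + Σ_j |V₀ⱼ|²/(ε − d)²)⁻¹` — the admixed (passive) weight is
`|V|²/Δ²` to leading order in hybridisation over level distance, EXACTLY `|V|²/(Δ² + |V|²)` here with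
`Δ = ε − d` the distance of the BAND energy (not the bare active level) from the shell
[cite: LiWu2022, App. «Bloch-Horowitz theory» (one-dimensional `P` space, `H_QQ = d·1`);
MarzariEtAl2012, §III.B.2 (the fold specialised to `H₁₁ = d·1`)]. -/
theorem activeWeight_eq_unique_scalar_passive [Unique m] {B : Matrix m n K} (d : K) (hd : IsSelfAdjoint d)
    {ε : K} (hε : IsSelfAdjoint ε) (hne : d ≠ ε) (x : m → K) (hx : star (x default) * x default ≠ 0) :
    star x ⬝ᵥ x / (star x ⬝ᵥ x
        + star (-((passiveRes (d • (1 : Matrix n n K)) ε * Bᴴ) *ᵥ x))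
            ⬝ᵥ (-((passiveRes (d • (1 : Matrix n n K)) ε * Bᴴ) *ᵥ x)))
      = (1 + (d - ε)⁻¹ * (d - ε)⁻¹ * ∑ j, B default j * star (B default j))⁻¹ := by
  have hD : (d • (1 : Matrix n n K)).IsHermitian := isHermitian_one.smul hd
  rw [activeWeight_eq_unique hD hε x hx, passiveRes_def, passiveRes_scalar d ε hne]
  congr 2
  simp only [Matrix.mul_smul, Matrix.mul_one, smul_smul, Matrix.smul_apply,
    Matrix.mul_apply, Matrix.conjTranspose_apply, smul_eq_mul, Finset.mul_sum, mul_assoc]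

/-- The same weight written as a ratio: `w = Δ²/(Δ² + Σ_j |V₀ⱼ|²)` with `Δ = d − ε`
(multiply numerator and denominator by `Δ²`) [cite: LiWu2022, App. «Bloch-Horowitz theory»;
MarzariEtAl2012, §III.B.2]. -/
theorem activeWeight_eq_unique_scalar_passive' [Unique m] {B : Matrix m n K} (d : K)
    (hd : IsSelfAdjoint d) {ε : K} (hε : IsSelfAdjoint ε) (hne : d ≠ ε) (x : m → K)
    (hx : star (x default) * x default ≠ 0) :
    star x ⬝ᵥ x / (star x ⬝ᵥ x
        + star (-((passiveRes (d • (1 : Matrix n n K)) ε * Bᴴ) *ᵥ x))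
            ⬝ᵥ (-((passiveRes (d • (1 : Matrix n n K)) ε * Bᴴ) *ᵥ x)))
      = (d - ε) * (d - ε) / ((d - ε) * (d - ε) + ∑ j, B default j * star (B default j)) := by
  rw [activeWeight_eq_unique_scalar_passive d hd hε hne x hx]
  have hΔ : d - ε ≠ 0 := sub_ne_zero.mpr hne
  field_simp

end weight

section derivative

open Filter
open scoped _root_.Topology

variable {𝕜 : Type*} [NontriviallyNormedField 𝕜]

/-- CONTINUITY OF THE PASSIVE RESOLVENT IN THE ENERGY off the passive spectrum (over `ℝ`, `ℂ` or any
nontrivially normed field) [cite: MarzariEtAl2012, §III.B.2 (the energy dependence of `(H₁₁ − ε)⁻¹`);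
continuity via Mathlib `continuousAt_matrix_inv`]. -/
theorem continuousAt_passiveRes (D : Matrix n n 𝕜) {ε₀ : 𝕜}
    (h : IsUnit (D - ε₀ • (1 : Matrix n n 𝕜)).det) :
    ContinuousAt (fun ε => passiveRes D ε) ε₀ := by
  have hcont : Continuous fun ε : 𝕜 => D - ε • (1 : Matrix n n 𝕜) :=
    continuous_const.sub (continuous_id.smul continuous_const)
  have hinv : ContinuousAt Inv.inv (D - ε₀ • (1 : Matrix n n 𝕜)) := by
    refine continuousAt_matrix_inv _ ?_
    rw [Ring.inverse_eq_inv']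
    exact continuousAt_inv₀ h.ne_zero
  have hfun : (fun ε => passiveRes D ε) = Inv.inv ∘ fun ε : 𝕜 => D - ε • (1 : Matrix n n 𝕜) := by
    funext ε
    simp [passiveRes_def]
  rw [hfun]
  exact ContinuousAt.comp (f := fun ε : 𝕜 => D - ε • (1 : Matrix n n 𝕜)) (x := ε₀) hinv
    hcont.continuousAt

/-- Off the passive spectrum at `ε₀`, nearby energies are off it too (the secular polynomial of the
passive block is continuous) [cite: MarzariEtAl2012, §III.B.2]. -/
theorem eventually_isUnit_det (D : Matrix n n 𝕜) {ε₀ : 𝕜}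
    (h : IsUnit (D - ε₀ • (1 : Matrix n n 𝕜)).det) :
    ∀ᶠ ε in 𝓝 ε₀, IsUnit (D - ε • (1 : Matrix n n 𝕜)).det := by
  have hcont : Continuous fun ε : 𝕜 => (D - ε • (1 : Matrix n n 𝕜)).det :=
    (continuous_const.sub (continuous_id.smul continuous_const)).matrix_det
  exact (hcont.continuousAt.eventually_ne h.ne_zero).mono fun ε hε => isUnit_iff_ne_zero.mpr hε

/-- THE ENERGY DERIVATIVE OF THE FOLD, entrywise: off the passive spectrum,
`∂_ε (H^eff₀₀(ε))_{ij} = −(V₀₁ (H₁₁ − ε)⁻¹ (H₁₁ − ε)⁻¹ V₁₀)_{ij}` — the limit of §4's exact secant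
`(H^eff₀₀(ε) − H^eff₀₀(ε₀))/(ε − ε₀) = −V₀₁ (H₁₁ − ε)⁻¹ (H₁₁ − ε₀)⁻¹ V₁₀`
[cite: LiWu2022, App. «Bloch-Horowitz theory» (`−∂H_eff(E)/∂E = H_PQ (E − H_QQ)⁻² H_QP`);
MarzariEtAl2012, §III.B.2 (the energy dependence an `n`th-order fit removes)]. -/
theorem hasDerivAt_effHam_apply (A : Matrix m m 𝕜) (B : Matrix m n 𝕜) (C : Matrix n m 𝕜)
    (D : Matrix n n 𝕜) {ε₀ : 𝕜} (h : IsUnit (D - ε₀ • (1 : Matrix n n 𝕜)).det) (i j : m) :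
    HasDerivAt (fun ε => effHam A B C D ε i j)
      (-((B * passiveRes D ε₀ * passiveRes D ε₀ * C) i j)) ε₀ := by
  rw [hasDerivAt_iff_tendsto_slope]
  -- the secant is exact (§4): slope = −(B R(ε) R(ε₀) C)ᵢⱼ for ε ≠ ε₀ near ε₀
  have hev : ∀ᶠ ε in 𝓝[≠] ε₀, slope (fun ε => effHam A B C D ε i j) ε₀ ε
      = -((B * passiveRes D ε * passiveRes D ε₀ * C) i j) := by
    filter_upwards [eventually_nhdsWithin_of_eventually_nhds (eventually_isUnit_det D h),
      self_mem_nhdsWithin] with ε hε hne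
    rw [slope_def_field]
    have hsub := effHam_sub_effHam A B C D hε h
    have hij : effHam A B C D ε i j - effHam A B C D ε₀ i j
        = (ε₀ - ε) * (B * passiveRes D ε * passiveRes D ε₀ * C) i j := by
      have := congrFun (congrFun hsub i) j
      simpa [Matrix.sub_apply, Matrix.smul_apply, passiveRes_def] using this
    rw [hij]
    have hne' : ε - ε₀ ≠ 0 := sub_ne_zero.mpr hne
    field_simp
    ring
  -- continuity of the secant's right-hand side at ε₀
  have hG : Continuous fun M : Matrix n n 𝕜 => (B * M * passiveRes D ε₀ * C) i j :=
    (((continuous_const.matrix_mul continuous_id).matrix_mul continuous_const).matrix_mul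
      continuous_const).matrix_elem i j
  have hcont : ContinuousAt (fun ε => -((B * passiveRes D ε * passiveRes D ε₀ * C) i j)) ε₀ :=
    (hG.continuousAt.comp (continuousAt_passiveRes D h)).neg
  exact (hcont.tendsto.mono_left nhdsWithin_le_nhds).congr' (hev.mono fun ε hε => hε.symm)

/-- THE ENERGY DERIVATIVE OF AN ACTIVE-SPACE EXPECTATION VALUE:
`∂_ε ⟨x, H^eff₀₀(ε) x⟩ = −⟨x, V₀₁ (H₁₁ − ε)⁻² V₁₀ x⟩` for a fixed active vector `x` — with §8's
`normSq_active_add_passive` this is the printed `1 = ⟨ψ_P|(1 − ∂_E H_eff)|ψ_P⟩`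
[cite: LiWu2022, App. «Bloch-Horowitz theory»; Lepage1997, §3]. -/
theorem hasDerivAt_dotProduct_effHam_mulVec [Fintype m] (A : Matrix m m 𝕜) (B : Matrix m n 𝕜)
    (C : Matrix n m 𝕜) (D : Matrix n n 𝕜) {ε₀ : 𝕜} (h : IsUnit (D - ε₀ • (1 : Matrix n n 𝕜)).det)
    (v x : m → 𝕜) :
    HasDerivAt (fun ε => v ⬝ᵥ (effHam A B C D ε *ᵥ x))
      (-(v ⬝ᵥ ((B * passiveRes D ε₀ * passiveRes D ε₀ * C) *ᵥ x))) ε₀ := by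
  have key : HasDerivAt (fun ε => ∑ i, v i * ∑ j, effHam A B C D ε i j * x j)
      (∑ i, v i * ∑ j, -((B * passiveRes D ε₀ * passiveRes D ε₀ * C) i j) * x j) ε₀ := by
    refine HasDerivAt.fun_sum fun i _ => ?_
    refine HasDerivAt.const_mul (v i) ?_
    exact HasDerivAt.fun_sum fun j _ => (hasDerivAt_effHam_apply A B C D h i j).mul_const (x j)
  have h1 : (fun ε => v ⬝ᵥ (effHam A B C D ε *ᵥ x))
      = fun ε => ∑ i, v i * ∑ j, effHam A B C D ε i j * x j := by
    funext ε
    simp [dotProduct, mulVec]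
  have h2 : -(v ⬝ᵥ ((B * passiveRes D ε₀ * passiveRes D ε₀ * C) *ᵥ x))
      = ∑ i, v i * ∑ j, -((B * passiveRes D ε₀ * passiveRes D ε₀ * C) i j) * x j := by
    simp [dotProduct, mulVec, Finset.mul_sum, Finset.sum_neg_distrib, mul_neg, neg_mul]
  rw [h1, h2]
  exact key

end derivative

/-! ### §9 Level-shift levers: a passive-level shift is an energy shift of the fold, and the derivative
of a folded eigenvalue with respect to the active (passive) level is the active (passive) weight -/

section levelshift_algebra

/-- SHIFTING THE PASSIVE LEVELS IS SHIFTING THE ENERGY ARGUMENT OF THE RESOLVENT: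
`((D − s·1) − ε·1)⁻¹ = (D − (ε + s)·1)⁻¹` — the resolvent depends on `D` and `ε` only through `D − ε·1`
[cite: MarzariEtAl2012, §III.B.2 (the passive resolvent `(H₁₁ − ε)⁻¹`)]. -/
theorem passiveRes_sub_smul_one (D : Matrix n n K) (s ε : K) :
    passiveRes (D - s • (1 : Matrix n n K)) ε = passiveRes D (ε + s) := by
  rw [passiveRes_def, passiveRes_def, sub_sub, ← add_smul, add_comm s ε]

/-- A RIGID SHIFT OF THE PASSIVE BLOCK IS AN ENERGY SHIFT OF THE FOLD:
`H^eff[A, B, C, D − s·1](ε) = H^eff[A, B, C, D](ε + s)` — lowering every removed level by `s` is the same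
as evaluating the original energy-dependent fold at `ε + s` (the fold depends on the passive block only
through `(H₁₁ − ε)⁻¹`) [cite: MarzariEtAl2012, §III.B.2]. -/
theorem effHam_passive_shift (A : Matrix m m K) (B : Matrix m n K) (C : Matrix n m K)
    (D : Matrix n n K) (s ε : K) :
    effHam A B C (D - s • (1 : Matrix n n K)) ε = effHam A B C D (ε + s) := by
  unfold effHam
  rw [passiveRes_sub_smul_one]

/-- The same with the opposite sign: raising the passive levels by `s` evaluates the fold at `ε − s`
[cite: MarzariEtAl2012, §III.B.2]. -/
theorem effHam_passive_shift' (A : Matrix m m K) (B : Matrix m n K) (C : Matrix n m K)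
    (D : Matrix n n K) (s ε : K) :
    effHam A B C (D + s • (1 : Matrix n n K)) ε = effHam A B C D (ε - s) := by
  have h := effHam_passive_shift A B C D (-s) ε
  rwa [neg_smul, sub_neg_eq_add, ← sub_eq_add_neg] at h

/-- A RIGID SHIFT OF THE ACTIVE BLOCK PASSES THROUGH THE FOLD UNCHANGED:
`H^eff[A + s·1, B, C, D](ε) = H^eff[A, B, C, D](ε) + s·1` (the passive tail `V₀₁ (H₁₁ − ε)⁻¹ V₁₀` does
not see the active level) [cite: MarzariEtAl2012, §III.B.2]. -/
theorem effHam_active_shift [DecidableEq m] (A : Matrix m m K) (B : Matrix m n K) (C : Matrix n m K)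
    (D : Matrix n n K) (s ε : K) :
    effHam (A + s • (1 : Matrix m m K)) B C D ε = effHam A B C D ε + s • (1 : Matrix m m K) := by
  unfold effHam
  rw [add_sub_right_comm]


/-- **EXACT SECANT FORM OF THE ACTIVE-LEVEL LEVER (no calculus, one kept orbital).** If `λ₁` and `λ₂`
are band energies of the one-orbital folded problem with the ACTIVE level shifted by `s₁` resp. `s₂`,
i.e. `λᵢ = H^eff₀₀(λᵢ) + sᵢ` (§2's secular equation for a singleton active block), both off the passive
spectrum, then `(λ₁ − λ₂) · (1 + S₁₂) = s₁ − s₂` with the TWO-ENERGY sandwich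
`S₁₂ = (B (D − λ₁)⁻¹ (D − λ₂)⁻¹ C)₀₀` — §4's exact linearisation error turned into a lever: the band
follows the kept level at the rate `(1 + S₁₂)⁻¹`, whose `λ₂ → λ₁` limit is the kept-orbital weight of
§8 [cite: MarzariEtAl2012, §III.B.2 (the energy dependence of `H^eff₀₀`)] — the finite-difference form of
the Hellmann–Feynman value [cite: Olshanii2013, §8.3.1 p. 77 (Hellmann–Feynman theorem)]; located use
[cite: VucicevicZitko2026, App. B]. -/
theorem activeShift_secant [Unique m] (A : Matrix m m K) (B : Matrix m n K) (C : Matrix n m K)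
    (D : Matrix n n K) {lam₁ lam₂ s₁ s₂ : K} (h₁ : IsUnit (D - lam₁ • (1 : Matrix n n K)).det)
    (h₂ : IsUnit (D - lam₂ • (1 : Matrix n n K)).det)
    (e₁ : lam₁ = effHam A B C D lam₁ default default + s₁)
    (e₂ : lam₂ = effHam A B C D lam₂ default default + s₂) :
    (lam₁ - lam₂) * (1 + (B * passiveRes D lam₁ * passiveRes D lam₂ * C) default default) = s₁ - s₂ := by
  have hsub := effHam_sub_effHam A B C D h₁ h₂
  have h00 : effHam A B C D lam₁ default default - effHam A B C D lam₂ default default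
      = (lam₂ - lam₁) * (B * passiveRes D lam₁ * passiveRes D lam₂ * C) default default := by
    have := congrFun (congrFun hsub default) default
    simpa [Matrix.sub_apply, Matrix.smul_apply, passiveRes_def] using this
  linear_combination e₁ - e₂ + h00

/-- **EXACT SECANT FORM OF THE PASSIVE-LEVEL LEVER.** If `μ₁`, `μ₂` are band energies of the one-orbital
folded problem with the PASSIVE block shifted by `s₁` resp. `s₂`, `μᵢ = H^eff[D + sᵢ·1](μᵢ)₀₀`, both
off the shifted passive spectra, then with the sandwich at the two unshifted energies
`S′ = (B (D − (μ₁ − s₁))⁻¹ (D − (μ₂ − s₂))⁻¹ C)₀₀` one has `(μ₁ − μ₂)(1 + S′) = (s₁ − s₂) S′`: the band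
follows the removed levels at the rate `S′/(1 + S′)`, whose limit is the removed-orbital weight
[cite: MarzariEtAl2012, §III.B.2] [cite: Olshanii2013, §8.3.1 p. 77 (Hellmann–Feynman theorem)]. -/
theorem passiveShift_secant [Unique m] (A : Matrix m m K) (B : Matrix m n K) (C : Matrix n m K)
    (D : Matrix n n K) {mu₁ mu₂ s₁ s₂ : K} (h₁ : IsUnit (D - (mu₁ - s₁) • (1 : Matrix n n K)).det)
    (h₂ : IsUnit (D - (mu₂ - s₂) • (1 : Matrix n n K)).det)
    (e₁ : mu₁ = effHam A B C (D + s₁ • (1 : Matrix n n K)) mu₁ default default)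
    (e₂ : mu₂ = effHam A B C (D + s₂ • (1 : Matrix n n K)) mu₂ default default) :
    (mu₁ - mu₂) * (1 + (B * passiveRes D (mu₁ - s₁) * passiveRes D (mu₂ - s₂) * C) default default)
      = (s₁ - s₂) * (B * passiveRes D (mu₁ - s₁) * passiveRes D (mu₂ - s₂) * C) default default := by
  rw [effHam_passive_shift'] at e₁ e₂
  have hsub := effHam_sub_effHam A B C D h₁ h₂
  have h00 : effHam A B C D (mu₁ - s₁) default default - effHam A B C D (mu₂ - s₂) default default
      = ((mu₂ - s₂) - (mu₁ - s₁))
          * (B * passiveRes D (mu₁ - s₁) * passiveRes D (mu₂ - s₂) * C) default default := by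
    have := congrFun (congrFun hsub default) default
    simpa [Matrix.sub_apply, Matrix.smul_apply, passiveRes_def] using this
  linear_combination e₁ - e₂ + h00

end levelshift_algebra

section levelshift_deriv

open Filter
open scoped _root_.Topology

variable {𝕜 : Type*} [NontriviallyNormedField 𝕜]

/-- **THE ACTIVE-LEVEL LEVER OF A FOLDED EIGENVALUE IS THE ACTIVE WEIGHT** (Hellmann–Feynman in fold form,
one kept orbital). Let the active level be shifted rigidly, `A ↦ A + s·1` (e.g. the Hartree
double-counting shift `E_dc` applied to `ε_d` of a `d–p` model), and let `s ↦ λ(s)` be a differentiable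
branch of band energies of the shifted problem, i.e. a solution of the exact one-orbital secular equation
`λ(s) = H^eff[A, B, C, D](λ(s))₀₀ + s` near `s₀` (§2 `det_sub_eq_zero_iff` with `m` a singleton), off the
passive spectrum. Then `λ′(s₀) · (1 + S) = 1` with `S = (B (D − λ)⁻² C)₀₀ = −∂_ε H^eff₀₀` (§8), i.e.
`dλ/ds = (1 + S)⁻¹` = THE ACTIVE-ORBITAL WEIGHT of the exact eigenvector (`activeWeight_eq_unique`).
The band moves with the kept level at the rate of its kept-orbital content: the Hellmann–Feynman theorem
`dE/ds = ⟨ψ|dH/ds|ψ⟩` [cite: Olshanii2013, §8.3.1 p. 77 (Hellmann–Feynman theorem)] with `dH/ds = P_active`,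
in the weight form `(1 − ∂_E H_eff)⁻¹` [cite: LiWu2022, App. «Bloch-Horowitz theory»]; located use
[cite: VucicevicZitko2026, App. B] — the top `d–p` eigenband read AFTER the double-counting shift of `ε_d`
«is not the same as what one would normally have in the effective Hubbard model. The difference is
significant both in shape and the bandwidth». The hypotheses ask for the branch `λ` (its existence /
differentiability is the implicit-function theorem, not re-proved here); the conclusion is forced by
uniqueness of derivatives. -/
theorem activeShift_eigenvalue_deriv_mul [Unique m] (A : Matrix m m 𝕜) (B : Matrix m n 𝕜)
    (C : Matrix n m 𝕜) (D : Matrix n n 𝕜) {lam : 𝕜 → 𝕜} {s₀ lam' : 𝕜} (hlam : HasDerivAt lam lam' s₀)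
    (hD : IsUnit (D - lam s₀ • (1 : Matrix n n 𝕜)).det)
    (hfix : ∀ᶠ s in 𝓝 s₀, lam s = effHam A B C D (lam s) default default + s) :
    lam' * (1 + (B * passiveRes D (lam s₀) * passiveRes D (lam s₀) * C) default default) = 1 := by
  set S : 𝕜 := (B * passiveRes D (lam s₀) * passiveRes D (lam s₀) * C) default default with hS
  have hg : HasDerivAt (fun s => effHam A B C D (lam s) default default + s) (-S * lam' + 1) s₀ := by
    have h1 : HasDerivAt (fun s => effHam A B C D (lam s) default default) (-S * lam') s₀ :=
      (hasDerivAt_effHam_apply A B C D hD default default).comp s₀ hlam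
    exact h1.add (hasDerivAt_id s₀)
  have heq : lam' = -S * lam' + 1 := hlam.unique (hg.congr_of_eventuallyEq hfix)
  linear_combination heq

/-- The same lever solved for the derivative: `dλ/ds = (1 + S)⁻¹` (the product form shows `1 + S ≠ 0`
automatically) [cite: Olshanii2013, §8.3.1 p. 77 (Hellmann–Feynman theorem)] [cite: LiWu2022, App.
«Bloch-Horowitz theory»]. -/
theorem activeShift_eigenvalue_deriv_eq [Unique m] (A : Matrix m m 𝕜) (B : Matrix m n 𝕜)
    (C : Matrix n m 𝕜) (D : Matrix n n 𝕜) {lam : 𝕜 → 𝕜} {s₀ lam' : 𝕜} (hlam : HasDerivAt lam lam' s₀)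
    (hD : IsUnit (D - lam s₀ • (1 : Matrix n n 𝕜)).det)
    (hfix : ∀ᶠ s in 𝓝 s₀, lam s = effHam A B C D (lam s) default default + s) :
    lam' = (1 + (B * passiveRes D (lam s₀) * passiveRes D (lam s₀) * C) default default)⁻¹ :=
  eq_inv_of_mul_eq_one_left (activeShift_eigenvalue_deriv_mul A B C D hlam hD hfix)

/-- **… AND IT IS LITERALLY THE ACTIVE-SUBSPACE WEIGHT OF THE TRUE EIGENVECTOR** (Hermitian blocks
`C = Bᴴ`, `D` Hermitian, self-adjoint band energy): with `x` the (one-component) active part and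
`y = −(D − λ)⁻¹ Bᴴ x` the passive tail of the exact eigenvector (§3), `dλ/ds = ⟨x,x⟩/(⟨x,x⟩ + ⟨y,y⟩)`
[cite: Olshanii2013, §8.3.1 p. 77 (Hellmann–Feynman theorem)]; the weight identity is §8
`activeWeight_eq_unique` [cite: LiWu2022, App. «Bloch-Horowitz theory»] [cite: Lepage1997, §3]. -/
theorem activeShift_eigenvalue_deriv_eq_activeWeight [Unique m] [StarRing 𝕜] (A : Matrix m m 𝕜)
    {B : Matrix m n 𝕜} {D : Matrix n n 𝕜} (hDh : D.IsHermitian) {lam : 𝕜 → 𝕜} {s₀ lam' : 𝕜}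
    (hlam : HasDerivAt lam lam' s₀) (hD : IsUnit (D - lam s₀ • (1 : Matrix n n 𝕜)).det)
    (hfix : ∀ᶠ s in 𝓝 s₀, lam s = effHam A B Bᴴ D (lam s) default default + s)
    (hε : IsSelfAdjoint (lam s₀)) (x : m → 𝕜) (hx : star (x default) * x default ≠ 0) :
    lam' = star x ⬝ᵥ x / (star x ⬝ᵥ x
        + star (-((passiveRes D (lam s₀) * Bᴴ) *ᵥ x)) ⬝ᵥ (-((passiveRes D (lam s₀) * Bᴴ) *ᵥ x))) := by
  rw [activeWeight_eq_unique hDh hε x hx]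
  exact activeShift_eigenvalue_deriv_eq A B Bᴴ D hlam hD hfix

/-- **THE PASSIVE-LEVEL LEVER IS THE PASSIVE WEIGHT**: shift the removed block rigidly, `D ↦ D + s·1`
(e.g. move the O-`2p` levels of a `d–p` model relative to the kept `d` orbital), and let `s ↦ μ(s)` be a
differentiable branch of band energies of the shifted problem,
`μ(s) = H^eff[A, B, C, D + s·1](μ(s))₀₀`, off the (shifted) passive spectrum. Then
`μ′(s₀) · (1 + S) = S` with `S` the sandwich at the unshifted energy `μ(s₀) − s₀`, i.e.
`dμ/ds = S/(1 + S) = 1 − (1 + S)⁻¹` = ONE MINUS THE ACTIVE WEIGHT = the removed-orbital content of the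
band — Hellmann–Feynman with `dH/ds = P_passive` [cite: Olshanii2013, §8.3.1 p. 77 (Hellmann–Feynman
theorem)], weight form [cite: LiWu2022, App. «Bloch-Horowitz theory»]. -/
theorem passiveShift_eigenvalue_deriv_mul [Unique m] (A : Matrix m m 𝕜) (B : Matrix m n 𝕜)
    (C : Matrix n m 𝕜) (D : Matrix n n 𝕜) {mu : 𝕜 → 𝕜} {s₀ mu' : 𝕜} (hmu : HasDerivAt mu mu' s₀)
    (hD : IsUnit (D - (mu s₀ - s₀) • (1 : Matrix n n 𝕜)).det)
    (hfix : ∀ᶠ s in 𝓝 s₀, mu s = effHam A B C (D + s • (1 : Matrix n n 𝕜)) (mu s) default default) :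
    mu' * (1 + (B * passiveRes D (mu s₀ - s₀) * passiveRes D (mu s₀ - s₀) * C) default default)
      = (B * passiveRes D (mu s₀ - s₀) * passiveRes D (mu s₀ - s₀) * C) default default := by
  set S : 𝕜 := (B * passiveRes D (mu s₀ - s₀) * passiveRes D (mu s₀ - s₀) * C) default default with hS
  have hfix' : ∀ᶠ s in 𝓝 s₀, mu s = effHam A B C D (mu s - s) default default :=
    hfix.mono fun s hs => by rwa [effHam_passive_shift'] at hs
  have h2 : HasDerivAt (fun s => mu s - s) (mu' - 1) s₀ := hmu.sub (hasDerivAt_id s₀)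
  have hg : HasDerivAt ((fun ε => effHam A B C D ε default default) ∘ fun s => mu s - s)
      (-S * (mu' - 1)) s₀ :=
    HasDerivAt.comp s₀ (h := fun s => mu s - s) (hasDerivAt_effHam_apply A B C D hD default default) h2
  have heq : mu' = -S * (mu' - 1) := hmu.unique (hg.congr_of_eventuallyEq hfix')
  linear_combination heq

/-- The passive lever solved: `dμ/ds = 1 − (1 + S)⁻¹` whenever `1 + S ≠ 0` [cite: Olshanii2013, §8.3.1
p. 77 (Hellmann–Feynman theorem)] [cite: LiWu2022, App. «Bloch-Horowitz theory»]. -/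
theorem passiveShift_eigenvalue_deriv_eq [Unique m] (A : Matrix m m 𝕜) (B : Matrix m n 𝕜)
    (C : Matrix n m 𝕜) (D : Matrix n n 𝕜) {mu : 𝕜 → 𝕜} {s₀ mu' : 𝕜} (hmu : HasDerivAt mu mu' s₀)
    (hD : IsUnit (D - (mu s₀ - s₀) • (1 : Matrix n n 𝕜)).det)
    (hfix : ∀ᶠ s in 𝓝 s₀, mu s = effHam A B C (D + s • (1 : Matrix n n 𝕜)) (mu s) default default)
    (h1S : 1 + (B * passiveRes D (mu s₀ - s₀) * passiveRes D (mu s₀ - s₀) * C) default default ≠ 0) :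
    mu' = 1 - (1 + (B * passiveRes D (mu s₀ - s₀) * passiveRes D (mu s₀ - s₀) * C) default default)⁻¹ := by
  have h := passiveShift_eigenvalue_deriv_mul A B C D hmu hD hfix
  set S : 𝕜 := (B * passiveRes D (mu s₀ - s₀) * passiveRes D (mu s₀ - s₀) * C) default default with hS
  have h' : mu' = S / (1 + S) := by
    rw [eq_div_iff h1S]
    exact h
  rw [h']
  field_simp
  ring

/-- SUM RULE: the two levers add up to one — shifting the kept AND the removed levels by the same `s` is a
rigid shift of the whole Hamiltonian, which moves every band by exactly `s`:
`(1 + S)⁻¹ + (1 − (1 + S)⁻¹) = 1` (Hellmann–Feynman with `dH/ds = 1`) [cite: Olshanii2013, §8.3.1 p. 77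
(Hellmann–Feynman theorem)]. -/
theorem activeLever_add_passiveLever (S : 𝕜) : (1 + S)⁻¹ + (1 - (1 + S)⁻¹) = 1 := by
  ring

/-- **HOW A LEVEL SHIFT CHANGES A DISPERSION** (the «shape and bandwidth» statement, exactly): two folded
band energies `λ₁(s)`, `λ₂(s)` — e.g. the same antibonding band at two crystal momenta, whose Bloch blocks
`B, C, D` differ while the kept level `A + s·1` is shared — separate at the rate of the CONTRAST of their
kept-orbital weights: `d(λ₁ − λ₂)/ds = (1 + S₁)⁻¹ − (1 + S₂)⁻¹ = w₁ − w₂`. A rigid double-counting shift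
of `ε_d` therefore changes the WIDTH of the one-band image of a `d–p` model by (shift) × (difference of
`d`-weights between band top and band bottom), and leaves it unchanged only if the `d`-weight is uniform
along the band [cite: Olshanii2013, §8.3.1 p. 77 (Hellmann–Feynman theorem)]; located use
[cite: VucicevicZitko2026, App. B]. -/
theorem hasDerivAt_activeShift_gap {lam₁ lam₂ : 𝕜 → 𝕜} {s₀ l₁ l₂ S₁ S₂ : 𝕜}
    (h1 : HasDerivAt lam₁ l₁ s₀) (h2 : HasDerivAt lam₂ l₂ s₀) (e1 : l₁ * (1 + S₁) = 1)
    (e2 : l₂ * (1 + S₂) = 1) :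
    HasDerivAt (fun s => lam₁ s - lam₂ s) ((1 + S₁)⁻¹ - (1 + S₂)⁻¹) s₀ := by
  rw [← eq_inv_of_mul_eq_one_left e1, ← eq_inv_of_mul_eq_one_left e2]
  exact h1.sub h2

end levelshift_deriv

end Literature.MathematicalPhysics.QuantumLattice.Loewdin
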